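import Mathlib
import Literature.Computability.AlgebraicComplexity.SimultaneousDoubleProduct
import Summits.MatrixMultiplication.MatrixMultiplication.Theses.FourierTwoFamiliesModP
import Summits.MatrixMultiplication.MatrixMultiplication.Theorems.FourierTwoFamiliesModPRemovalRegime
import Summits.MatrixMultiplication.MatrixMultiplication.Theorems.FourierTwoFamiliesModPPowerGainRefutes

/-!
# Line `corner-gain` for crux `PrimeCyclicPowerGain` (stmt-MatrixMultiplication-14309) — ladder-down rung

Forward generator G4 (`ladder-down`, seat `fwd-ladder-MatrixMultiplication-51`).  The crux
`PrimeCyclicPowerGain` (`∃ c > 0, s₀: n · s^{1+c} ≤ p` for every balanced SDPP configuration of `n` pairs of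
`s`-subsets of `ℤ/p`, `s ≥ s₀`) is graded here by the REGIME `n` versus `s`:

* graded family `CornerSaving K f` : in the LINEAR REGIME `n ≤ K·s`, saving `f(s)`: `n · s · f(s) ≤ p`;
* FLOOR (proved, in tree): `cornerSaving_const : CornerSaving K (fun _ => C)` for every `K, C` — this is the
  route's support item `RemovalRegime` (stmt-14314, `Theorems.removalRegime_proof`, Green's arithmetic removal
  lemma with `k = 3`) specialised to the host `ℤ/p`;
* RUNG (crux #1 of the line, OPEN): `CornerGain : ∀ K, ∃ c > 0, CornerSaving K (fun s => s ^ c)` — a POWER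
  saving in the linear regime (ONE parameter moved from the floor: the saving, constant ↦ power; equivalently,
  by passing to sub-families, the square case `n = s`: `s^{2+c} ≤ p`);
* GAP (limit step, declared crux-equivalent in substance — see the line card): `SuperlinearGain` = the same
  power saving in the complementary regime `n ≥ K·s` for ONE `K`;
* composition: `powerGain_of_gains : CornerGain → SuperlinearGain → (the crux statement, unfolded)` (proved,
  sorry-free), `primeCyclicPowerGain_iff_gains : PrimeCyclicPowerGain ↔ CornerGain ∧ SuperlinearGain` (proved), and the
  SKELETON `PrimeCyclicPowerGain_of : PrimeCyclicPowerGain := powerGain_of_gains stub_cornerGain stub_superlinearGain`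
  (concludes the crux BY NAME; kernel-checked modulo the two stubs);
* on-path checks `cornerGain_of_primeCyclicPowerGain`, `superlinearGain_of_primeCyclicPowerGain` (both proved:
  the rung and the gap are consequences of the crux);
* BYPASS (proved here, the point of the rung for the ROUTE): `not_primeTwoFamilies_of_cornerGain :
  CornerGain → ¬ PrimeTwoFamilies` — the rung ALONE already does the job the crux was filed for
  (`PowerGainRefutes`), because a near-extremal two-families configuration (`p ≤ n^{2+δ}`,
  `|A_i||B_i| ≥ n^{2-δ}`) contains, after Markov + shrinking (as in `Theorems.PowerGainRefutes_proof`), a SQUARE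
  sub-configuration of `s` pairs of `s`-sets with `s ≥ n^{1-2δ}/4`, to which `CornerSaving 1 (· ^ c)` applies:
  `s^{2+c} ≤ p ≤ n^{2+δ}` forces `n^{c/2} ≤ 4^{2+c}` for the slice `δ = c/(2(5+2c))`.

Sorries: exactly the two registered stubs `stub_cornerGain`, `stub_superlinearGain`.
-/

-- single-conjunct summit: the mandated namespace repeats `MatrixMultiplication`.
set_option linter.dupNamespace false

namespace Summit.MatrixMultiplication.MatrixMultiplication.Cruxes.PrimeCyclicPowerGain.CornerGain

open Summit.MatrixMultiplication.MatrixMultiplication.Theses.FourierTwoFamiliesModP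
open Literature.Computability.AlgebraicComplexity

/-- The graded family of the ladder: saving `f` in the linear regime `n ≤ K·s`.  For every prime `p`
and every balanced SDPP configuration `(A i, B i)_{i < n}` of `s`-subsets of `ZMod p` with `s ≥ s₀` and
`n ≤ K·s`: `n · s · f(s) ≤ p`.  (Binders (balance), (W), (X) verbatim as in the crux.) -/
def CornerSaving (K : ℝ) (f : ℕ → ℝ) : Prop :=
  ∃ s₀ : ℕ, ∀ p : ℕ, p.Prime → ∀ (n s : ℕ) (A B : Fin n → Finset (ZMod p)), s₀ ≤ s →
    (n : ℝ) ≤ K * (s : ℝ) →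
    (∀ i : Fin n, (A i).card = s ∧ (B i).card = s) →
    (∀ i : Fin n, ∀ a ∈ A i, ∀ a' ∈ A i, ∀ b ∈ B i, ∀ b' ∈ B i,
      (a - a') + (b - b') = 0 → a = a' ∧ b = b') →
    (∀ i j k : Fin n, ∀ a ∈ A i, ∀ a' ∈ A j, ∀ b ∈ B j, ∀ b' ∈ B k,
      (a - a') + (b - b') = 0 → i = k) →
    (n : ℝ) * (s : ℝ) * f s ≤ (p : ℝ)

/-- **FLOOR (proved).** Constant saving in the linear regime, for every `K` and every constant `C`:
the route's support item `RemovalRegime` (Green's arithmetic removal lemma, `k = 3`; tree theorem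
`Theorems.removalRegime_proof`, stated for every finite abelian group) specialised to `ZMod p` with
`ε = 1/C`. -/
theorem cornerSaving_const (K C : ℝ) : CornerSaving K (fun _ => C) := by
  by_cases hC : C ≤ 0
  · refine ⟨0, ?_⟩
    intro p hp n s A B _ _ _ _ _
    have h1 : (n : ℝ) * (s : ℝ) * C ≤ 0 := mul_nonpos_of_nonneg_of_nonpos (by positivity) hC
    exact h1.trans (Nat.cast_nonneg p)
  · push Not at hC
    have hR := Summit.MatrixMultiplication.MatrixMultiplication.Theorems.removalRegime_proof
    unfold RemovalRegime at hR
    obtain ⟨s₀, hs₀⟩ := hR K (1 / C) (by positivity)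
    refine ⟨s₀, ?_⟩
    intro p hp n s A B hs hK hcard hW hX
    haveI : Fact p.Prime := ⟨hp⟩
    have h := hs₀ (ZMod p) n s A B hs hK hcard hW hX
    rw [ZMod.card] at h
    have h2 := mul_le_mul_of_nonneg_right h hC.le
    calc (n : ℝ) * (s : ℝ) * C ≤ 1 / C * (p : ℝ) * C := h2
      _ = (p : ℝ) := by field_simp

/-- **RUNG (crux #1 of the line, open).** Power saving in the linear regime: for every `K` there is
`c > 0` with `n · s^{1+c} ≤ p` for all balanced SDPP configurations in `ZMod p` with `n ≤ K·s`, `s ≥ s₀(K)`.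
Open for every `0 < c < log(81/28)/log 7 ≈ 0.546` (the radix-9 digit design of `Cruxes/…/Disproof.lean`
lives in the band `n ≤ s`); equivalent, via sub-families, to the square case `n = s`: `s^{2+c} ≤ p`. -/
def CornerGain : Prop :=
  ∀ K : ℝ, ∃ c : ℝ, 0 < c ∧ CornerSaving K (fun s => (s : ℝ) ^ c)

/-- **GAP (the limit step; crux-equivalent in substance by translate boosting — see the line card).**
Power saving in the complementary regime `n ≥ K·s` for ONE constant `K`. -/
def SuperlinearGain : Prop :=
  ∃ c : ℝ, 0 < c ∧ ∃ K : ℝ, ∃ s₀ : ℕ, ∀ p : ℕ, p.Prime → ∀ (n s : ℕ) (A B : Fin n → Finset (ZMod p)),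
    s₀ ≤ s → K * (s : ℝ) ≤ (n : ℝ) →
    (∀ i : Fin n, (A i).card = s ∧ (B i).card = s) →
    (∀ i : Fin n, ∀ a ∈ A i, ∀ a' ∈ A i, ∀ b ∈ B i, ∀ b' ∈ B i,
      (a - a') + (b - b') = 0 → a = a' ∧ b = b') →
    (∀ i j k : Fin n, ∀ a ∈ A i, ∀ a' ∈ A j, ∀ b ∈ B j, ∀ b' ∈ B k,
      (a - a') + (b - b') = 0 → i = k) →
    (n : ℝ) * (s : ℝ) ^ (1 + c) ≤ (p : ℝ)

/-- Registered stub: the RUNG. -/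
theorem stub_cornerGain : CornerGain := by
  sorry

/-- Registered stub: the GAP (limit step). -/
theorem stub_superlinearGain : SuperlinearGain := by
  sorry

/-- **Ladder composition (proved, sorry-free): rung + gap ⇒ the crux's statement** (stated UNFOLDED, so
that the only theorem concluding the crux by name is the skeleton `PrimeCyclicPowerGain_of` below).  With
`c := min c₁ c₂` and `s₀ := max (max s₁ s₂) 1`, split on the regime `n ≤ K·s` / `n > K·s`. -/
theorem powerGain_of_gains (hC : CornerGain) (hS : SuperlinearGain) :
    ∃ c : ℝ, 0 < c ∧ ∃ s₀ : ℕ, ∀ p : ℕ, p.Prime → ∀ (n s : ℕ) (A B : Fin n → Finset (ZMod p)), s₀ ≤ s →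
      (∀ i : Fin n, (A i).card = s ∧ (B i).card = s) →
      (∀ i : Fin n, ∀ a ∈ A i, ∀ a' ∈ A i, ∀ b ∈ B i, ∀ b' ∈ B i,
        (a - a') + (b - b') = 0 → a = a' ∧ b = b') →
      (∀ i j k : Fin n, ∀ a ∈ A i, ∀ a' ∈ A j, ∀ b ∈ B j, ∀ b' ∈ B k,
        (a - a') + (b - b') = 0 → i = k) →
      (n : ℝ) * (s : ℝ) ^ (1 + c) ≤ (p : ℝ) := by
  obtain ⟨c₂, hc₂, K, s₂, hS'⟩ := hS
  obtain ⟨c₁, hc₁, s₁, hC'⟩ := hC K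
  refine ⟨min c₁ c₂, lt_min hc₁ hc₂, max (max s₁ s₂) 1, ?_⟩
  intro p hp n s A B hs hcard hW hX
  have hs1 : s₁ ≤ s := le_trans (le_trans (le_max_left _ _) (le_max_left _ _)) hs
  have hs2 : s₂ ≤ s := le_trans (le_trans (le_max_right _ _) (le_max_left _ _)) hs
  have hs3 : 1 ≤ s := le_trans (le_max_right _ _) hs
  have hsR : (1 : ℝ) ≤ (s : ℝ) := by exact_mod_cast hs3
  have hspos : (0 : ℝ) < (s : ℝ) := by linarith
  by_cases hband : (n : ℝ) ≤ K * (s : ℝ)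
  · have h : (n : ℝ) * (s : ℝ) * (s : ℝ) ^ c₁ ≤ (p : ℝ) := hC' p hp n s A B hs1 hband hcard hW hX
    have h1 : (s : ℝ) ^ (1 + min c₁ c₂) ≤ (s : ℝ) * (s : ℝ) ^ c₁ := by
      rw [Real.rpow_add hspos, Real.rpow_one]
      exact mul_le_mul_of_nonneg_left
        (Real.rpow_le_rpow_of_exponent_le hsR (min_le_left _ _)) hspos.le
    calc (n : ℝ) * (s : ℝ) ^ (1 + min c₁ c₂) ≤ (n : ℝ) * ((s : ℝ) * (s : ℝ) ^ c₁) :=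
          mul_le_mul_of_nonneg_left h1 (Nat.cast_nonneg _)
      _ = (n : ℝ) * (s : ℝ) * (s : ℝ) ^ c₁ := by ring
      _ ≤ (p : ℝ) := h
  · push Not at hband
    have h := hS' p hp n s A B hs2 hband.le hcard hW hX
    have h1 : (s : ℝ) ^ (1 + min c₁ c₂) ≤ (s : ℝ) ^ (1 + c₂) :=
      Real.rpow_le_rpow_of_exponent_le hsR (by linarith [min_le_right c₁ c₂])
    calc (n : ℝ) * (s : ℝ) ^ (1 + min c₁ c₂) ≤ (n : ℝ) * (s : ℝ) ^ (1 + c₂) :=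
          mul_le_mul_of_nonneg_left h1 (Nat.cast_nonneg _)
      _ ≤ (p : ℝ) := h

/-- **On-path (proved): the crux implies the rung** (`s^{1+c} = s · s^c` for `s ≥ 1`). -/
theorem cornerGain_of_primeCyclicPowerGain
    (h : Summit.MatrixMultiplication.MatrixMultiplication.Theses.FourierTwoFamiliesModP.PrimeCyclicPowerGain) :
    CornerGain := by
  obtain ⟨c, hc, s₀, h'⟩ := h
  intro K
  refine ⟨c, hc, max s₀ 1, ?_⟩
  intro p hp n s A B hs _hK hcard hW hX
  have hs0 : s₀ ≤ s := le_trans (le_max_left _ _) hs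
  have hs1 : (1 : ℕ) ≤ s := le_trans (le_max_right _ _) hs
  have hspos : (0 : ℝ) < (s : ℝ) := by exact_mod_cast hs1
  have hmain := h' p hp n s A B hs0 hcard hW hX
  show (n : ℝ) * (s : ℝ) * (s : ℝ) ^ c ≤ (p : ℝ)
  calc (n : ℝ) * (s : ℝ) * (s : ℝ) ^ c = (n : ℝ) * (s : ℝ) ^ (1 + c) := by
        rw [Real.rpow_add hspos, Real.rpow_one]; ring
    _ ≤ (p : ℝ) := hmain

/-- **On-path (proved): the crux implies the gap** (drop the regime hypothesis). -/
theorem superlinearGain_of_primeCyclicPowerGain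
    (h : Summit.MatrixMultiplication.MatrixMultiplication.Theses.FourierTwoFamiliesModP.PrimeCyclicPowerGain) :
    SuperlinearGain := by
  obtain ⟨c, hc, s₀, h'⟩ := h
  exact ⟨c, hc, 0, s₀, fun p hp n s A B hs _ hcard hW hX => h' p hp n s A B hs hcard hW hX⟩

/-- **The ladder as an equivalence (proved): crux ⟺ rung ∧ gap.** -/
theorem primeCyclicPowerGain_iff_gains :
    Summit.MatrixMultiplication.MatrixMultiplication.Theses.FourierTwoFamiliesModP.PrimeCyclicPowerGain ↔
      (CornerGain ∧ SuperlinearGain) :=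
  ⟨fun h => ⟨cornerGain_of_primeCyclicPowerGain h, superlinearGain_of_primeCyclicPowerGain h⟩,
   fun h => powerGain_of_gains h.1 h.2⟩

/-- **SKELETON (kernel-checked modulo the two registered stubs): concludes the crux BY NAME.**
`stub_cornerGain` (rung) and `stub_superlinearGain` (gap), composed by `powerGain_of_gains`. -/
theorem PrimeCyclicPowerGain_of :
    Summit.MatrixMultiplication.MatrixMultiplication.Theses.FourierTwoFamiliesModP.PrimeCyclicPowerGain :=
  powerGain_of_gains stub_cornerGain stub_superlinearGain

/-- **BYPASS (proved): the rung alone refutes the route's target.**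
`CornerGain → ¬ PrimeTwoFamilies`: only `CornerSaving 1 (· ^ c)` is used.  Given a near-extremal witness
(`p ≤ n^{2+δ}`, `|A_i||B_i| ≥ n^{2-δ}`, `n` large) for the slice `δ := c/(2(5+2c))`: Markov on the packings
`Σ|A_i|, Σ|B_i| ≤ p` (`Theorems.powerGainRefutes_four_mul_card_filter_le`) leaves `m ≥ n/2` indices with
`|A_i|, |B_i| ≥ n^{1-2δ}/4 =: σ`; put `s := ⌈σ⌉ ≤ m`, keep `s` of these pairs, shrink them to size `s`
(`IsSDPP.reindex`, `IsSDPP.mono`) and apply the corner saving with `n = s`, `K = 1`: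
`σ^{2+c} ≤ s^{2+c} ≤ p ≤ n^{2+δ}`, i.e. `n^{c/2} ≤ 4^{2+c}` — false for `n` large.
(Bookkeeping adapted from `Theorems.PowerGainRefutes_proof`.) -/
theorem not_primeTwoFamilies_of_cornerGain (hCG : CornerGain) : ¬ PrimeTwoFamilies := by
  intro hT
  obtain ⟨c, hc, s₀, hgain⟩ := hCG 1
  -- the slice
  set δ : ℝ := c / (2 * (5 + 2 * c)) with hδ
  have h52 : 0 < 5 + 2 * c := by linarith
  have hδpos : 0 < δ := by positivity
  have hδE : c - δ * (5 + 2 * c) = c / 2 := by rw [hδ]; field_simp; ring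
  have hδ14 : δ < 1 / 4 := by
    rw [hδ, div_lt_iff₀ (by positivity)]; nlinarith
  have h12δ : 0 < 1 - 2 * δ := by linarith
  -- the constant to beat and the level
  set C : ℝ := (4 : ℝ) ^ (2 + c) with hC
  have hCpos : 0 < C := by positivity
  set T₁ : ℕ := ⌈C ^ (1 / (c / 2))⌉₊ with hT₁
  set T₂ : ℕ := ⌈((4 : ℝ) * (s₀ + 1)) ^ (1 / (1 - 2 * δ))⌉₊ with hT₂
  obtain ⟨n, hn, p, hp, A, B, hW, hX, hpn, hAB⟩ := hT δ hδpos (T₁ + T₂ + 4)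
  have hn4 : 4 ≤ n := by omega
  have hnpos : (0 : ℝ) < n := by exact_mod_cast (show 0 < n by omega)
  have hn1 : (1 : ℝ) ≤ n := by exact_mod_cast (show 1 ≤ n by omega)
  -- `C < n^{c/2}` and `4(s₀+1) < n^{1-2δ}`
  have hbigC : C < (n : ℝ) ^ (c / 2) := by
    have h1 := Nat.le_ceil (C ^ (1 / (c / 2)))
    have h2 : (T₁ : ℝ) < n := by exact_mod_cast (show T₁ < n by omega)
    have h3 : C ^ (1 / (c / 2)) < n := by rw [hT₁] at h2; linarith
    have h4 := Real.rpow_lt_rpow (Real.rpow_nonneg hCpos.le _) h3 (by positivity : 0 < c / 2)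
    rwa [← Real.rpow_mul hCpos.le, one_div_mul_cancel (by positivity), Real.rpow_one] at h4
  have hbigS : (4 : ℝ) * (s₀ + 1) < (n : ℝ) ^ (1 - 2 * δ) := by
    have h0 : (0 : ℝ) ≤ 4 * (s₀ + 1) := by positivity
    have h1 := Nat.le_ceil (((4 : ℝ) * (s₀ + 1)) ^ (1 / (1 - 2 * δ)))
    have h2 : (T₂ : ℝ) < n := by exact_mod_cast (show T₂ < n by omega)
    have h3 : ((4 : ℝ) * (s₀ + 1)) ^ (1 / (1 - 2 * δ)) < n := by rw [hT₂] at h2; linarith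
    have h4 := Real.rpow_lt_rpow (Real.rpow_nonneg h0 _) h3 h12δ
    rwa [← Real.rpow_mul h0, one_div_mul_cancel h12δ.ne', Real.rpow_one] at h4
  haveI : Fact p.Prime := ⟨hp⟩
  have hS : IsSDPP A B := ⟨hW, hX⟩
  -- non-emptiness and the packings `Σ|Aᵢ| ≤ p`, `Σ|Bᵢ| ≤ p`
  have hY : 0 < (n : ℝ) ^ (2 - δ) := Real.rpow_pos_of_pos hnpos _
  have hne : ∀ i : Fin n, (A i).Nonempty ∧ (B i).Nonempty := by
    intro i
    have h1 : 0 < (A i).card * (B i).card := by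
      have : (0 : ℝ) < (((A i).card * (B i).card : ℕ) : ℝ) := hY.trans_le (hAB i)
      exact_mod_cast this
    refine ⟨Finset.card_pos.1 (Nat.pos_of_ne_zero fun h0 => ?_),
      Finset.card_pos.1 (Nat.pos_of_ne_zero fun h0 => ?_)⟩
    · rw [h0, zero_mul] at h1; exact lt_irrefl 0 h1
    · rw [h0, mul_zero] at h1; exact lt_irrefl 0 h1
  have hsumA : ∑ i, (A i).card ≤ p := by
    have := hS.sum_card_left_le fun i => (hne i).2
    rwa [ZMod.card] at this
  have hsumB : ∑ i, (B i).card ≤ p := by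
    have := hS.sum_card_right_le fun i => (hne i).1
    rwa [ZMod.card] at this
  -- the good indices
  classical
  set good := (Finset.univ : Finset (Fin n)).filter
    (fun i => (A i).card * n ≤ 4 * p ∧ (B i).card * n ≤ 4 * p) with hgood
  have hbadA :=
    Summit.MatrixMultiplication.MatrixMultiplication.Theorems.powerGainRefutes_four_mul_card_filter_le
      (fun i => (A i).card) hsumA
  have hbadB :=
    Summit.MatrixMultiplication.MatrixMultiplication.Theorems.powerGainRefutes_four_mul_card_filter_le
      (fun i => (B i).card) hsumB
  have hgood_card : n ≤ 2 * good.card := by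
    have hsub : (Finset.univ : Finset (Fin n)) ⊆ good ∪
        ((Finset.univ : Finset (Fin n)).filter (fun i => 4 * p < (A i).card * n) ∪
         (Finset.univ : Finset (Fin n)).filter (fun i => 4 * p < (B i).card * n)) := by
      intro i _
      by_cases hA : (A i).card * n ≤ 4 * p
      · by_cases hB : (B i).card * n ≤ 4 * p
        · exact Finset.mem_union_left _ (Finset.mem_filter.2 ⟨Finset.mem_univ _, hA, hB⟩)
        · exact Finset.mem_union_right _ (Finset.mem_union_right _
            (Finset.mem_filter.2 ⟨Finset.mem_univ _, not_le.1 hB⟩))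
      · exact Finset.mem_union_right _ (Finset.mem_union_left _
          (Finset.mem_filter.2 ⟨Finset.mem_univ _, not_le.1 hA⟩))
    have h1 := Finset.card_le_card hsub
    rw [Finset.card_univ, Fintype.card_fin] at h1
    have h2 : (good ∪
        ((Finset.univ : Finset (Fin n)).filter (fun i => 4 * p < (A i).card * n) ∪
         (Finset.univ : Finset (Fin n)).filter (fun i => 4 * p < (B i).card * n))).card ≤
        good.card + (((Finset.univ : Finset (Fin n)).filter (fun i => 4 * p < (A i).card * n)).card +
          ((Finset.univ : Finset (Fin n)).filter (fun i => 4 * p < (B i).card * n)).card) :=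
      (Finset.card_union_le _ _).trans (Nat.add_le_add_left (Finset.card_union_le _ _) _)
    have h3 := h1.trans h2
    omega
  -- sizes on good indices: `|Aᵢ|, |Bᵢ| ≥ n^{1-2δ}/4`
  set s : ℕ := ⌈(n : ℝ) ^ (1 - 2 * δ) / 4⌉₊ with hs_def
  have hσnn : (0 : ℝ) ≤ (n : ℝ) ^ (1 - 2 * δ) / 4 := by positivity
  have hs_low : (n : ℝ) ^ (1 - 2 * δ) / 4 ≤ s := Nat.le_ceil _
  have hs₀ : s₀ ≤ s := by
    have : (s₀ : ℝ) < s := by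
      have : (s₀ : ℝ) + 1 < (n : ℝ) ^ (1 - 2 * δ) / 4 := by linarith
      linarith
    exact_mod_cast this.le
  -- `s ≤ #good`: `s < n^{1-2δ}/4 + 1 ≤ n/4 + 1` and `#good ≥ n/2`
  have hs_le_good : s ≤ good.card := by
    have h1 : (s : ℝ) < (n : ℝ) ^ (1 - 2 * δ) / 4 + 1 := Nat.ceil_lt_add_one hσnn
    have h2 : (n : ℝ) ^ (1 - 2 * δ) ≤ (n : ℝ) := by
      have := Real.rpow_le_rpow_of_exponent_le hn1 (show 1 - 2 * δ ≤ 1 by linarith)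
      rwa [Real.rpow_one] at this
    have h3 : (n : ℝ) ≤ 2 * (good.card : ℝ) := by exact_mod_cast hgood_card
    have h4 : (2 * s : ℕ) < (good.card + 2 : ℕ) := by
      have : (2 : ℝ) * s < good.card + 2 := by linarith
      exact_mod_cast this
    omega
  have hkey : ∀ i ∈ good, s ≤ (A i).card ∧ s ≤ (B i).card := by
    intro i hi
    obtain ⟨-, hA4, hB4⟩ := Finset.mem_filter.1 hi
    have hA4r : ((A i).card : ℝ) * n ≤ 4 * p := by exact_mod_cast hA4
    have hB4r : ((B i).card : ℝ) * n ≤ 4 * p := by exact_mod_cast hB4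
    have hprod : (n : ℝ) ^ (2 - δ) ≤ ((A i).card : ℝ) * ((B i).card : ℝ) := by
      have := hAB i; push_cast at this; exact this
    have hp4 : (4 : ℝ) * p ≤ 4 * (n : ℝ) ^ (2 + δ) := by linarith
    have e1 : (n : ℝ) ^ (2 - δ) * n = (n : ℝ) ^ (1 - 2 * δ) * (n : ℝ) ^ (2 + δ) := by
      rw [← Real.rpow_add hnpos, show (1 - 2 * δ + (2 + δ) : ℝ) = (2 - δ) + 1 by ring,
        Real.rpow_add hnpos, Real.rpow_one]
    have hpow : 0 < (n : ℝ) ^ (2 + δ) := Real.rpow_pos_of_pos hnpos _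
    have hBlow : (n : ℝ) ^ (1 - 2 * δ) / 4 ≤ (B i).card := by
      have h1 : (n : ℝ) ^ (2 - δ) * n ≤ ((B i).card : ℝ) * (4 * (n : ℝ) ^ (2 + δ)) := by
        calc (n : ℝ) ^ (2 - δ) * n ≤ ((A i).card : ℝ) * ((B i).card : ℝ) * n :=
              mul_le_mul_of_nonneg_right hprod hnpos.le
          _ = ((B i).card : ℝ) * (((A i).card : ℝ) * n) := by ring
          _ ≤ ((B i).card : ℝ) * (4 * p) := mul_le_mul_of_nonneg_left hA4r (Nat.cast_nonneg _)
          _ ≤ ((B i).card : ℝ) * (4 * (n : ℝ) ^ (2 + δ)) :=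
              mul_le_mul_of_nonneg_left hp4 (Nat.cast_nonneg _)
      rw [e1] at h1
      rw [div_le_iff₀ (by norm_num : (0 : ℝ) < 4)]
      have h2 : (n : ℝ) ^ (1 - 2 * δ) * (n : ℝ) ^ (2 + δ) ≤
          (((B i).card : ℝ) * 4) * (n : ℝ) ^ (2 + δ) := by
        linarith
      exact le_of_mul_le_mul_right h2 hpow
    have hAlow : (n : ℝ) ^ (1 - 2 * δ) / 4 ≤ (A i).card := by
      have h1 : (n : ℝ) ^ (2 - δ) * n ≤ ((A i).card : ℝ) * (4 * (n : ℝ) ^ (2 + δ)) := by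
        calc (n : ℝ) ^ (2 - δ) * n ≤ ((A i).card : ℝ) * ((B i).card : ℝ) * n :=
              mul_le_mul_of_nonneg_right hprod hnpos.le
          _ = ((A i).card : ℝ) * (((B i).card : ℝ) * n) := by ring
          _ ≤ ((A i).card : ℝ) * (4 * p) := mul_le_mul_of_nonneg_left hB4r (Nat.cast_nonneg _)
          _ ≤ ((A i).card : ℝ) * (4 * (n : ℝ) ^ (2 + δ)) :=
              mul_le_mul_of_nonneg_left hp4 (Nat.cast_nonneg _)
      rw [e1] at h1
      rw [div_le_iff₀ (by norm_num : (0 : ℝ) < 4)]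
      have h2 : (n : ℝ) ^ (1 - 2 * δ) * (n : ℝ) ^ (2 + δ) ≤
          (((A i).card : ℝ) * 4) * (n : ℝ) ^ (2 + δ) := by
        linarith
      exact le_of_mul_le_mul_right h2 hpow
    exact ⟨Nat.ceil_le.2 hAlow, Nat.ceil_le.2 hBlow⟩
  -- keep `s` good pairs, reindex them by `Fin s` and shrink them to size `s` (a SQUARE configuration)
  obtain ⟨good', hsub', hcard'⟩ := Finset.exists_subset_card_eq hs_le_good
  let ι : Fin s → Fin n := fun j => (good'.equivFin.symm (Fin.cast hcard'.symm j)).1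
  have hιmem : ∀ j, ι j ∈ good := fun j => hsub' (good'.equivFin.symm (Fin.cast hcard'.symm j)).2
  have hιinj : Function.Injective ι := by
    intro j j' h
    have h1 : good'.equivFin.symm (Fin.cast hcard'.symm j) = good'.equivFin.symm (Fin.cast hcard'.symm j') :=
      Subtype.ext h
    have h2 := good'.equivFin.symm.injective h1
    exact Fin.cast_injective _ h2
  have hA' : ∀ j : Fin s, ∃ A' : Finset (ZMod p), A' ⊆ A (ι j) ∧ A'.card = s :=
    fun j => Finset.exists_subset_card_eq (hkey _ (hιmem j)).1
  have hB' : ∀ j : Fin s, ∃ B' : Finset (ZMod p), B' ⊆ B (ι j) ∧ B'.card = s :=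
    fun j => Finset.exists_subset_card_eq (hkey _ (hιmem j)).2
  choose A' hA'sub hA'card using hA'
  choose B' hB'sub hB'card using hB'
  have hS' : IsSDPP A' B' := (hS.reindex ι hιinj).mono hA'sub hB'sub
  -- the corner saving with `n = s`, `K = 1`
  have hgain' : (s : ℝ) * (s : ℝ) * (s : ℝ) ^ c ≤ (p : ℝ) :=
    hgain p hp s s A' B' hs₀ (by simp) (fun j => ⟨hA'card j, hB'card j⟩) hS'.1 hS'.2
  -- numerics: `(n^{1-2δ}/4)^{2+c} ≤ s^{2+c} ≤ p ≤ n^{2+δ}`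
  have hspos : (0 : ℝ) < (s : ℝ) := by
    have : (0 : ℝ) < (n : ℝ) ^ (1 - 2 * δ) / 4 := by positivity
    linarith
  have e0 : (s : ℝ) * (s : ℝ) * (s : ℝ) ^ c = (s : ℝ) ^ (2 + c) := by
    rw [Real.rpow_add hspos, Real.rpow_two]; ring
  have h1 : ((n : ℝ) ^ (1 - 2 * δ) / 4) ^ (2 + c) ≤ (s : ℝ) ^ (2 + c) :=
    Real.rpow_le_rpow hσnn hs_low (by linarith)
  have h2 : ((n : ℝ) ^ (1 - 2 * δ) / 4) ^ (2 + c) =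
      (n : ℝ) ^ ((1 - 2 * δ) * (2 + c)) / (4 : ℝ) ^ (2 + c) := by
    rw [Real.div_rpow (Real.rpow_nonneg hnpos.le _) (by norm_num), ← Real.rpow_mul hnpos.le]
  have h3 : (n : ℝ) ^ ((1 - 2 * δ) * (2 + c)) / (4 : ℝ) ^ (2 + c) ≤ (n : ℝ) ^ (2 + δ) := by
    calc (n : ℝ) ^ ((1 - 2 * δ) * (2 + c)) / (4 : ℝ) ^ (2 + c)
        = ((n : ℝ) ^ (1 - 2 * δ) / 4) ^ (2 + c) := h2.symm
      _ ≤ (s : ℝ) ^ (2 + c) := h1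
      _ = (s : ℝ) * (s : ℝ) * (s : ℝ) ^ c := e0.symm
      _ ≤ p := hgain'
      _ ≤ (n : ℝ) ^ (2 + δ) := hpn
  have h4pos : (0 : ℝ) < (4 : ℝ) ^ (2 + c) := by positivity
  have h4 : (n : ℝ) ^ ((1 - 2 * δ) * (2 + c)) ≤ C * (n : ℝ) ^ (2 + δ) := by
    rw [div_le_iff₀ h4pos] at h3
    rw [hC]; linarith
  have e2 : (n : ℝ) ^ ((1 - 2 * δ) * (2 + c)) = (n : ℝ) ^ (c / 2) * (n : ℝ) ^ (2 + δ) := by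
    rw [← Real.rpow_add hnpos, ← hδE]
    congr 1; ring
  rw [e2] at h4
  have h5 : (n : ℝ) ^ (c / 2) ≤ C := le_of_mul_le_mul_right h4 (Real.rpow_pos_of_pos hnpos _)
  linarith

end Summit.MatrixMultiplication.MatrixMultiplication.Cruxes.PrimeCyclicPowerGain.CornerGain
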